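import Mathlib
import Summits.NavierStokesRegularity.NavierStokesRegularity.Theorems.ThreadingFluxHorizonTowerProfileCurlLambda
import HarnessLib

/-!
# Crux `PoloidalLiouville` (stmt-NavierStokesRegularity-1222, wall W1), crux idea «horizon-threading-tower» (ns-idea-15):
# RUNG R4 of the identification chain — the first contraction `⟪x, curl(λ × Ω)(x)⟫ = 2κ² (‖x‖²)^{(1−3l)/2} · det(∇H, ∇G, x)`

Support file (Theorems-side tooling, `--supports stmt-NavierStokesRegularity-1222 --as helper`; seat ns-wall-eng-7 g3, cell ns-wall-extremal).
Fourth rung of the STRUCTURED identification chain of the engine identity E-𝔏₂ (DATUM B-ht2, `pub/ns-wall-extremal/ARM-B/w7g3/L2-IDENTITY.md` §2 (4)).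
With `U = U_H`, `Ω = curl U`, `λ = U × Ω`, `κ = (l−1)(l+2)`, `G = ‖∇H‖²` and `D(x) := ⟪x, ∇H(x) × ∇G(x)⟫ = det(∇H, ∇G, x)`:

* `HorizonTower.cross_lamb_omega_pointwise` — the algebra `(A∇H + By) × (C ∇H×y) = C(A⟪∇H,y⟫ + B‖y‖²) ∇H − C(A‖∇H‖² + B⟪∇H,y⟫) y`;
* `HorizonTower.lambOmega_horizonProfile` — `λ × Ω` in closed form off the origin (`α ∇H + β x` with explicit `α, β`);
* `HorizonTower.inner_curl_lambOmega_horizonProfile` — ★ `⟪x, curl(λ × Ω)(x)⟫ = (2κ²(‖x‖²)^{(1−3l)/2}) · D(x)`.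

Pure vector calculus; information-grade for W1/W2; `PoloidalLiouville` (1222) / NS regularity OPEN and untouched. [folklore]
-/

-- the summit and its single problem share the name (D-0017 nested layout)
set_option linter.dupNamespace false

noncomputable section

open Set Function Filter Topology
open scoped Topology RealInnerProductSpace
open Literature.Analysis.FluidPDE
open Literature.Geometry.DiscreteGeometry (inner_fin3 norm_sq_fin3)

namespace Summit.NavierStokesRegularity.NavierStokesRegularity.Theorems.PoloidalLiouville.HorizonTower

open PoloidalField

/-- BAC–CAB bookkeeping: `(A g + B y) × (C (g × y)) = (C(A⟪g,y⟫ + B⟪y,y⟫)) g − (C(A‖g‖² + B⟪g,y⟫)) y`.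
[cite: MajdaBertozziCUP2002, §1.1 (vector identities)] -/
theorem cross_lamb_omega_pointwise (g y : E3) (A B C L R : ℝ) (hEu : ⟪g, y⟫ = L) (hR : ⟪y, y⟫ = R) :
    cross (A • g + B • y) (C • cross g y) = (C * (A * L + B * R)) • g - (C * (A * ‖g‖ ^ 2 + B * L)) • y := by
  rw [inner_fin3] at hEu hR
  rw [norm_sq_fin3]
  obtain ⟨c0, c1, c2⟩ := cross_fin3 g y
  obtain ⟨e0, e1, e2⟩ := cross_fin3 (A • g + B • y) (C • cross g y)
  ext i
  fin_cases i
  · simp only [Fin.zero_eta, Fin.isValue, PiLp.sub_apply, PiLp.add_apply, PiLp.smul_apply, smul_eq_mul, e0, c1, c2]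
    linear_combination (g 0 * A * C - y 0 * B * C) * hEu + (g 0 * B * C) * hR
  · simp only [Fin.mk_one, Fin.isValue, PiLp.sub_apply, PiLp.add_apply, PiLp.smul_apply, smul_eq_mul, e1, c0, c2]
    linear_combination (g 1 * A * C - y 1 * B * C) * hEu + (g 1 * B * C) * hR
  · simp only [Fin.reduceFinMk, Fin.isValue, PiLp.sub_apply, PiLp.add_apply, PiLp.smul_apply, smul_eq_mul, e2, c0, c1]
    linear_combination (g 2 * A * C - y 2 * B * C) * hEu + (g 2 * B * C) * hR

/-- `⟪x, P × ∇H(x)⟫` for `P = a ∇(H²-type) + b x + c ∇G …`: the generic contraction `⟪x, (p • u + q • x + r • w) × u⟫ = −r ⟪x, u × w⟫`.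
[cite: MajdaBertozziCUP2002, §1.1 (vector identities)] -/
theorem inner_cross_combination_left (p q r : ℝ) (u w x : E3) :
    ⟪x, cross (p • u + q • x + r • w) u⟫ = -r * ⟪x, cross u w⟫ := by
  obtain ⟨c0, c1, c2⟩ := cross_fin3 (p • u + q • x + r • w) u
  obtain ⟨d0, d1, d2⟩ := cross_fin3 u w
  rw [inner_fin3, inner_fin3, c0, c1, c2, d0, d1, d2]
  simp only [PiLp.add_apply, PiLp.smul_apply, smul_eq_mul]
  ring

/-- `⟪x, v × x⟫ = 0`. [folklore] -/
theorem inner_cross_self_right (v x : E3) : ⟪x, cross v x⟫ = 0 := by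
  obtain ⟨c0, c1, c2⟩ := cross_fin3 v x
  rw [inner_fin3, c0, c1, c2]
  ring

section T1

variable {l : ℕ} {H : E3 → ℝ}

/-- **`λ × Ω` in closed form** off the origin: `λ × Ω = α • ∇H + β • x` with
`α = 2κ²(l²H²(‖x‖²)^{−(3l+1)/2} − ‖∇H‖²(‖x‖²)^{(1−3l)/2})`, `β = −κ²l(l−1)(H‖∇H‖²(‖x‖²)^{−(3l+1)/2} − l²H³(‖x‖²)^{−(3l+3)/2})`. [folklore] -/
theorem lambOmega_horizonProfile (hl : 1 ≤ l) (hH : ContDiff ℝ (⊤ : ℕ∞) H)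
    (hhom : ∀ (c : ℝ) (y : E3), H (c • y) = c ^ l * H y) (hharm : ∀ y, Laplacian.laplacian H y = 0) {x : E3} (hx : x ≠ 0) :
    cross (cross (horizonProfile l H 0 x) (curl (horizonProfile l H 0) x)) (curl (horizonProfile l H 0) x)
      = ((2 * (((l : ℝ) - 1) * ((l : ℝ) + 2)) ^ 2 * (l : ℝ) ^ 2) * (H x ^ 2 * (‖x‖ ^ 2) ^ (-(3 * (l : ℝ) + 1) / 2))
          + (-2 * (((l : ℝ) - 1) * ((l : ℝ) + 2)) ^ 2) * (‖gradient H x‖ ^ 2 * (‖x‖ ^ 2) ^ ((1 - 3 * (l : ℝ)) / 2))) • gradient H x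
        + ((-(((l : ℝ) - 1) * ((l : ℝ) + 2)) ^ 2 * (l : ℝ) * ((l : ℝ) - 1)) * (H x * ‖gradient H x‖ ^ 2 * (‖x‖ ^ 2) ^ (-(3 * (l : ℝ) + 1) / 2))
          + ((((l : ℝ) - 1) * ((l : ℝ) + 2)) ^ 2 * (l : ℝ) ^ 3 * ((l : ℝ) - 1)) * (H x ^ 3 * (‖x‖ ^ 2) ^ (-(3 * (l : ℝ) + 3) / 2))) • x := by
  have hHd : DifferentiableAt ℝ H x := (hH.differentiable (by simp)).differentiableAt
  have hq : 0 < ‖x‖ ^ 2 := by positivity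
  have hEu : ⟪gradient H x, x⟫ = (l : ℝ) * H x := by rw [inner_gradient_eq_fderiv, fderiv_apply_self_of_homogeneous_nat hHd hhom]
  have hR : ⟪x, x⟫ = ‖x‖ ^ 2 := real_inner_self_eq_norm_sq x
  have hsub : ∀ (a b : ℝ) (u v : E3), a • u - b • v = a • u + (-b) • v := fun a b u v => by rw [neg_smul, sub_eq_add_neg]
  rw [cross_horizonProfile_curl hl hH hhom hharm hx, curl_horizonProfile hl hH hhom hharm hx, hsub,
    cross_lamb_omega_pointwise _ _ _ _ _ _ _ hEu hR, hsub]
  -- scalar bookkeeping of the powers of ‖x‖²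
  have s1 : (‖x‖ ^ 2) ^ (-((l : ℝ) + 1) / 2) * (‖x‖ ^ 2) ^ (-(l : ℝ)) = (‖x‖ ^ 2) ^ (-(3 * (l : ℝ) + 1) / 2) := by
    rw [← Real.rpow_add hq]; congr 1; ring
  have s2 : (‖x‖ ^ 2) ^ (-(3 * (l : ℝ) + 1) / 2) * ‖x‖ ^ 2 = (‖x‖ ^ 2) ^ ((1 - 3 * (l : ℝ)) / 2) := by
    conv_lhs => rw [show (‖x‖ ^ 2) ^ (-(3 * (l : ℝ) + 1) / 2) * ‖x‖ ^ 2
      = (‖x‖ ^ 2) ^ (-(3 * (l : ℝ) + 1) / 2) * (‖x‖ ^ 2) ^ (1 : ℝ) by rw [Real.rpow_one]]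
    rw [← Real.rpow_add hq]; congr 1; ring
  have s3 : (‖x‖ ^ 2) ^ (-((l : ℝ) + 1) / 2) * (‖x‖ ^ 2) ^ (-(l : ℝ) - 1) = (‖x‖ ^ 2) ^ (-(3 * (l : ℝ) + 3) / 2) := by
    rw [← Real.rpow_add hq]; congr 1; ring
  have s4 : (‖x‖ ^ 2) ^ (-(3 * (l : ℝ) + 3) / 2) * ‖x‖ ^ 2 = (‖x‖ ^ 2) ^ (-(3 * (l : ℝ) + 1) / 2) := by
    conv_lhs => rw [show (‖x‖ ^ 2) ^ (-(3 * (l : ℝ) + 3) / 2) * ‖x‖ ^ 2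
      = (‖x‖ ^ 2) ^ (-(3 * (l : ℝ) + 3) / 2) * (‖x‖ ^ 2) ^ (1 : ℝ) by rw [Real.rpow_one]]
    rw [← Real.rpow_add hq]; congr 1; ring
  congr 1
  · congr 1
    linear_combination ((((l : ℝ) - 1) * ((l : ℝ) + 2)) ^ 2 * (l : ℝ) ^ 2 * ((l : ℝ) + 1) * H x ^ 2) * s1
      - (2 * (((l : ℝ) - 1) * ((l : ℝ) + 2)) ^ 2 * ‖gradient H x‖ ^ 2 * ‖x‖ ^ 2) * s1
      - (2 * (((l : ℝ) - 1) * ((l : ℝ) + 2)) ^ 2 * ‖gradient H x‖ ^ 2) * s2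
      - ((((l : ℝ) - 1) * ((l : ℝ) + 2)) ^ 2 * (l : ℝ) ^ 2 * ((l : ℝ) - 1) * H x ^ 2 * ‖x‖ ^ 2) * s3
      - ((((l : ℝ) - 1) * ((l : ℝ) + 2)) ^ 2 * (l : ℝ) ^ 2 * ((l : ℝ) - 1) * H x ^ 2) * s4
  · congr 1
    linear_combination (-(((l : ℝ) - 1) * ((l : ℝ) + 2)) ^ 2 * (l : ℝ) * ((l : ℝ) - 1) * H x * ‖gradient H x‖ ^ 2) * s1
      + ((((l : ℝ) - 1) * ((l : ℝ) + 2)) ^ 2 * (l : ℝ) ^ 3 * ((l : ℝ) - 1) * H x ^ 3) * s3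

/-- ★ **R4: the first contraction.**  `⟪x, curl(λ × Ω)(x)⟫ = (2κ²(‖x‖²)^{(1−3l)/2}) · ⟪x, ∇H(x) × ∇G(x)⟫`, `G = ‖∇H‖²`. [folklore] -/
theorem inner_curl_lambOmega_horizonProfile (hl : 1 ≤ l) (hH : ContDiff ℝ (⊤ : ℕ∞) H)
    (hhom : ∀ (c : ℝ) (y : E3), H (c • y) = c ^ l * H y) (hharm : ∀ y, Laplacian.laplacian H y = 0) {x : E3} (hx : x ≠ 0) :
    ⟪x, curl (fun z => cross (cross (horizonProfile l H 0 z) (curl (horizonProfile l H 0) z)) (curl (horizonProfile l H 0) z)) x⟫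
      = (2 * (((l : ℝ) - 1) * ((l : ℝ) + 2)) ^ 2 * (‖x‖ ^ 2) ^ ((1 - 3 * (l : ℝ)) / 2))
          * ⟪x, cross (gradient H x) (gradient (fun y => ‖gradient H y‖ ^ 2) x)⟫ := by
  have hHd : ∀ z, DifferentiableAt ℝ H z := fun z => (hH.differentiable (by simp)).differentiableAt
  have hGd : ∀ z, DifferentiableAt ℝ (gradient H) z :=
    fun z => ((contDiff_gradient hH (n := 1) (by norm_cast)).differentiable (by simp)).differentiableAt
  have hNd : ∀ z, DifferentiableAt ℝ (fun y => ‖gradient H y‖ ^ 2) z := fun z => (hGd z).norm_sq ℝ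
  have hopen : ∀ᶠ y in 𝓝 x, y ≠ (0 : E3) := isOpen_compl_singleton.mem_nhds hx
  set κ : ℝ := ((l : ℝ) - 1) * ((l : ℝ) + 2) with hκ
  set α : E3 → ℝ := fun y => (2 * κ ^ 2 * (l : ℝ) ^ 2) * (H y ^ 2 * (‖y‖ ^ 2) ^ (-(3 * (l : ℝ) + 1) / 2))
      + (-2 * κ ^ 2) * (‖gradient H y‖ ^ 2 * (‖y‖ ^ 2) ^ ((1 - 3 * (l : ℝ)) / 2)) with hα
  set β : E3 → ℝ := fun y => (-κ ^ 2 * (l : ℝ) * ((l : ℝ) - 1)) * (H y * ‖gradient H y‖ ^ 2 * (‖y‖ ^ 2) ^ (-(3 * (l : ℝ) + 1) / 2))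
      + (κ ^ 2 * (l : ℝ) ^ 3 * ((l : ℝ) - 1)) * (H y ^ 3 * (‖y‖ ^ 2) ^ (-(3 * (l : ℝ) + 3) / 2)) with hβ
  have hev : (fun z => cross (cross (horizonProfile l H 0 z) (curl (horizonProfile l H 0) z)) (curl (horizonProfile l H 0) z))
      =ᶠ[𝓝 x] fun y => α y • gradient H y + β y • y := by
    filter_upwards [hopen] with y hy
    rw [lambOmega_horizonProfile hl hH hhom hharm hy]
  rw [curl_eq_curlCLM, hev.fderiv_eq, ← curl_eq_curlCLM]
  -- differentiability at x
  have hR : ∀ p : ℝ, DifferentiableAt ℝ (fun y : E3 => (‖y‖ ^ 2) ^ p) x := fun p =>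
    (contDiffAt_rpow_normSq hx p (n := 1)).differentiableAt (by simp)
  have hH2 : DifferentiableAt ℝ (fun y => H y ^ 2) x := (hHd x).pow 2
  have hH3 : DifferentiableAt ℝ (fun y => H y ^ 3) x := (hHd x).pow 3
  have hρ1 : DifferentiableAt ℝ (fun y : E3 => H y ^ 2 * (‖y‖ ^ 2) ^ (-(3 * (l : ℝ) + 1) / 2)) x := hH2.mul (hR _)
  have hρ2 : DifferentiableAt ℝ (fun y : E3 => ‖gradient H y‖ ^ 2 * (‖y‖ ^ 2) ^ ((1 - 3 * (l : ℝ)) / 2)) x := (hNd x).mul (hR _)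
  have hρ3 : DifferentiableAt ℝ (fun y : E3 => H y * ‖gradient H y‖ ^ 2 * (‖y‖ ^ 2) ^ (-(3 * (l : ℝ) + 1) / 2)) x :=
    ((hHd x).mul (hNd x)).mul (hR _)
  have hρ4 : DifferentiableAt ℝ (fun y : E3 => H y ^ 3 * (‖y‖ ^ 2) ^ (-(3 * (l : ℝ) + 3) / 2)) x := hH3.mul (hR _)
  have hαd : DifferentiableAt ℝ α x := (hρ1.const_mul _).add (hρ2.const_mul _)
  have hβd : DifferentiableAt ℝ β x := (hρ3.const_mul _).add (hρ4.const_mul _)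
  have h1 : DifferentiableAt ℝ (fun y => α y • gradient H y) x := hαd.smul (hGd x)
  have h2 : DifferentiableAt ℝ (fun y => β y • y) x := hβd.smul differentiableAt_id
  rw [curl_eq_curlCLM, fderiv_fun_add h1 h2, map_add, ← curl_eq_curlCLM, ← curl_eq_curlCLM, curl_smul_eq_cross hαd (hGd x),
    curl_smul_self hβd, curl_gradient_eq_zero_of_contDiffAt (hH.contDiffAt.of_le (by norm_cast)), smul_zero, zero_add,
    inner_add_right, inner_cross_self_right, add_zero]
  -- the gradient of α
  have hG2 : gradient (fun y => H y ^ 2) x = (2 * H x) • gradient H x := by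
    have : (fun y => H y ^ 2) = fun y => H y * H y := funext fun y => sq (H y)
    rw [this, gradient_mul_apply (hHd x) (hHd x), ← add_smul]; congr 1; ring
  have hgα : gradient α x = (2 * κ ^ 2 * (l : ℝ) ^ 2) • ((‖x‖ ^ 2) ^ (-(3 * (l : ℝ) + 1) / 2) • ((2 * H x) • gradient H x)
        + (2 * ((-(3 * (l : ℝ) + 1) / 2) * (‖x‖ ^ 2) ^ (-(3 * (l : ℝ) + 1) / 2 - 1)) * H x ^ 2) • x)
      + (-2 * κ ^ 2) • ((‖x‖ ^ 2) ^ ((1 - 3 * (l : ℝ)) / 2) • gradient (fun y => ‖gradient H y‖ ^ 2) x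
        + (2 * (((1 - 3 * (l : ℝ)) / 2) * (‖x‖ ^ 2) ^ ((1 - 3 * (l : ℝ)) / 2 - 1)) * ‖gradient H x‖ ^ 2) • x) := by
    rw [hα, gradient_const_mul_add_const_mul hρ1 hρ2, gradient_mul_rpow_normSq hx hH2,
      gradient_mul_rpow_normSq hx (hNd x), hG2]
  rw [hgα]
  -- regroup as `p • ∇H + q • x + r • ∇G` and contract
  have hgrp : (2 * κ ^ 2 * (l : ℝ) ^ 2) • ((‖x‖ ^ 2) ^ (-(3 * (l : ℝ) + 1) / 2) • ((2 * H x) • gradient H x)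
        + (2 * ((-(3 * (l : ℝ) + 1) / 2) * (‖x‖ ^ 2) ^ (-(3 * (l : ℝ) + 1) / 2 - 1)) * H x ^ 2) • x)
      + (-2 * κ ^ 2) • ((‖x‖ ^ 2) ^ ((1 - 3 * (l : ℝ)) / 2) • gradient (fun y => ‖gradient H y‖ ^ 2) x
        + (2 * (((1 - 3 * (l : ℝ)) / 2) * (‖x‖ ^ 2) ^ ((1 - 3 * (l : ℝ)) / 2 - 1)) * ‖gradient H x‖ ^ 2) • x)
      = (2 * κ ^ 2 * (l : ℝ) ^ 2 * ((‖x‖ ^ 2) ^ (-(3 * (l : ℝ) + 1) / 2) * (2 * H x))) • gradient H x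
        + ((2 * κ ^ 2 * (l : ℝ) ^ 2) * (2 * ((-(3 * (l : ℝ) + 1) / 2) * (‖x‖ ^ 2) ^ (-(3 * (l : ℝ) + 1) / 2 - 1)) * H x ^ 2)
            + (-2 * κ ^ 2) * (2 * (((1 - 3 * (l : ℝ)) / 2) * (‖x‖ ^ 2) ^ ((1 - 3 * (l : ℝ)) / 2 - 1)) * ‖gradient H x‖ ^ 2)) • x
        + ((-2 * κ ^ 2) * (‖x‖ ^ 2) ^ ((1 - 3 * (l : ℝ)) / 2)) • gradient (fun y => ‖gradient H y‖ ^ 2) x := by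
    module
  rw [hgrp, inner_cross_combination_left]
  ring

end T1

end Summit.NavierStokesRegularity.NavierStokesRegularity.Theorems.PoloidalLiouville.HorizonTower

end
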